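import Summits.AtomisticToContinuum.Crystallization.Theorems.ChartedPlanarOrderChannelCertC182

/-!
# BOX-RESTRICTED twins of the 7c‴ channel leaves, targets and endpoints (decomp-a2c lens-3 g25, repair R-a of critic rows 502/503)

SCOPE FINDING (critic row 502, standing): the certificate leaves of record — `AdjacentChannelRefT/S`, `FarChannelBelowRefT/S`
(`…TubeChannelsTS`) and their Hessian dictionaries `HessCertAdj/HessCertFar` (`…ChannelJacobian`) — quantify over the FULL binder family of
`TubeConvexRef (17/16) (1/40)` (every `δ`-separated stacked reference over independent periods of norm `≤ 17/16`, clean-W, UNIFORMLY CLEAN,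
zero gap stress), whereas a census certificate (TAG 182 / C182 §R1) covers a BOX SUB-FAMILY (e.g. `a′ ∈ [0.966, 0.976]`, references within
`δ ≤ 0.006 / 0.010` of the equilibrium registry).  So the four literal Props of `…ChannelCertC182.tubeConvexRef_of_leafCerts_C182` are
CERT·M on the box sub-family only.

REPAIR R-a (this file, typing only): thread an ARBITRARY restriction predicate `B a b w'` on the reference through the binders, AFTER
`UniformlyClean (Layered a b w')` and before the branch predicate, in every leaf, target and certificate, and re-prove the consumers VERBATIM:

* §1 the per-configuration seam `tubeConvexData_of_channelData` (channel data ⇒ convex data round ONE reference; the Ref-level proof of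
  `…TubeChannelsRef.tubeConvexRef_record_of_channels` localised);
* §2 the box-restricted targets `TubeConvexRefBox Λ₁ ρ B`, `TubeUniquenessRefBox Λ₁ ρ B` (+ the seam `TubeConvexRefBox → TubeUniquenessRefBox`,
  the twin of `…TubeConvex.tubeUniquenessRef_of_tubeConvexRef`) and leaves `AdjacentChannelRefTBox/SBox Λ₁ ρ B l_T l_N`,
  `FarChannelBelowRefTBox/SBox Λ₁ ρ B μ_T μ_N s₀`; monotonicity in `B` and the recovery `B := fun _ _ _ => True` ⇔ the leaves/targets of record;
* §3 the consumers `tubeConvexRefBox_record_of_branch_certs_sharp / ₆` (= `…PairModulusSharp.tubeConvexRef_record_of_branch_certs_sharp / ₆`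
  with `B` threaded; tail budgets `7/10` (T) / `9/4` (S) at `s₀ = 6` from the PROVED `pairModulusTailRef_sharp` machinery, which needs no box);
* §4 the Hessian certificates `HessCertAdjBox/HessCertFarBox Ψ` with a configuration predicate `Ψ a b w'` (instantiated at `B ∧ PhiT`, `B ∧ PhiS`),
  their wrappers and `tubeConvexRefBox_of_hessCerts₆`;
* §5 the C182 endpoints on the box family: `tubeConvexRefBox_of_leafCerts_C182`, `tubeConvexRefBox_of_hessCerts_C182` (constants of
  `…ChannelCertC182` verbatim).

What `B` is, is NOT decided here: lens-4 (pinning, TAG 183) names the box literal `B₀` for which the cone consumes 7c‴ only on `B₀`-references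
and supplies the one seam lemma re-pointing slot 7c‴ to `TubeUniquenessRefBox (17/16) (1/40) B₀` (or `TubeConvexRefBox`); the census (R1′) certifies
the four `…Box … B₀` leaves (a tracking cover of `B₀`).  With `B := ⊤` everything here is the statement of record (§2 recoveries), so the file is
answer-independent.
-/

noncomputable section

namespace Summit.AtomisticToContinuum.Crystallization.Theorems.ChartedPlanarOrderTubeChannelsBox

open Metric Set
open scoped RealInnerProductSpace
open Summit.AtomisticToContinuum.Crystallization.Theorems.ChartedPlanarOrderRigidityDoor (E3)
open Summit.AtomisticToContinuum.Crystallization.Theorems.ChartedPlanarOrderDensityDichotomy (IsSep μS)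
open Summit.AtomisticToContinuum.Crystallization.Theorems.ChartedPlanarOrderDoorLayered (Layered)
open Summit.AtomisticToContinuum.Crystallization.Theorems.ChartedPlanarOrderProfileSlavingLJ (incr tube IsStacked gapStress)
open Summit.AtomisticToContinuum.Crystallization.Theorems.OverbindingBudgetScaleWidening (IsCleanW)
open Summit.AtomisticToContinuum.Crystallization.Theorems.OverbindingBudgetPeriodicCleanOrStrained (UniformlyClean)
open Summit.AtomisticToContinuum.Crystallization.Theorems.OverbindingBudgetStackedRigidityUniq (TubeUniquenessRef)
open Summit.AtomisticToContinuum.Crystallization.Theorems.ChartedPlanarOrderTubeConvex (TubeConvexData TubeConvexRef incr_eq_of_tubeConvex)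
open Summit.AtomisticToContinuum.Crystallization.Theorems.ChartedPlanarOrderTubeConvexSplit (tubeConvexData_of_split)
open Summit.AtomisticToContinuum.Crystallization.Theorems.ChartedPlanarOrderStraddleLipschitz (summable_famOf_tube
  tubeLipschitzData_of_pairModulus)
open Summit.AtomisticToContinuum.Crystallization.Theorems.ChartedPlanarOrderPairModulus (pairModulus_of_cleanP_stacked)
open Summit.AtomisticToContinuum.Crystallization.Theorems.ChartedPlanarOrderTubeChannels (tng IsAdjacentChannelMono IsFarChannelModulusBelow
  TubeChannelData tubeConvexityData_of_channels tubeChannelData_of_certs)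
open Summit.AtomisticToContinuum.Crystallization.Theorems.ChartedPlanarOrderTubeChannelsTS (AdjacentChannelRefT AdjacentChannelRefS
  FarChannelBelowRefT FarChannelBelowRefS)
open Summit.AtomisticToContinuum.Crystallization.Theorems.ChartedPlanarOrderStackedUniform (stackedUniform)
open Summit.AtomisticToContinuum.Crystallization.Theorems.ChartedPlanarOrderHeightFloor (cleanStackedWindows)
open Summit.AtomisticToContinuum.Crystallization.Theorems.ChartedPlanarOrderPairModulusSharp (thetaSq sharpConst tailBudget exists_tail_of_floor)
open Summit.AtomisticToContinuum.Crystallization.Theorems.ChartedPlanarOrderChannelJacobian (hess HessCertAdj HessCertFar PhiT PhiS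
  isAdjacentChannelMono_of_hess isFarChannelModulusBelow_of_hess)
open Summit.AtomisticToContinuum.Crystallization.Theorems.ChartedPlanarOrderChannelCertC182 (muT muN muT' muN' muT_nonneg muN_nonneg
  muT'_nonneg muN'_nonneg sum_muT sum_muN sum_muT' sum_muN' alT alN ga alT' alN' ga')

/-! ## §1 The per-configuration seam: channel data ⇒ convex data round one reference -/

/-- ★ channel dominance data on the `ρ`-tube round ONE clean stacked reference (`‖a‖, ‖b‖ ≤ 17/16`, `ρ < 19/50`) give the convex data there
(pair moduli `pairModulus_of_cleanP_stacked` ⇒ Lipschitz half and tube summability; `tubeConvexityData_of_channels`; `tubeConvexData_of_split`). -/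
theorem tubeConvexData_of_channelData {δ : ℝ} {a b : E3} {w' : ℤ → E3} (hδ : 0 < δ) (hst : IsStacked a b w')
    (hab : LinearIndependent ℝ ![a, b]) (ha : ‖a‖ ≤ 17 / 16) (hb : ‖b‖ ≤ 17 / 16) (hs : IsSep δ (Layered a b w'))
    (hc : IsCleanW (μS (Layered a b w'))) {ρ : ℝ} (hρ : ρ < 19 / 50) (hC : TubeChannelData a b w' ρ) : TubeConvexData a b w' ρ := by
  obtain ⟨τ, hτ0, hτ3, hPM⟩ := pairModulus_of_cleanP_stacked (aHi := 103 / 100) (by norm_num) hρ hδ hs hc hst ha hb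
  exact tubeConvexData_of_split (tubeLipschitzData_of_pairModulus hδ hab hst hs hτ0 hτ3 hPM)
    (tubeConvexityData_of_channels (fun m _ hh => summable_famOf_tube hδ hab hst hs hτ0 hτ3 hPM m hh) hC)

/-! ## §2 Box-restricted targets and leaves -/

/-- 7c‴ ON THE BOX FAMILY `B`: convex data round every reference of record that satisfies `B a b w'`. -/
def TubeConvexRefBox (Λ₁ ρ : ℝ) (B : E3 → E3 → (ℤ → E3) → Prop) : Prop :=
  ∀ δ : ℝ, 0 < δ → ∀ (a b : E3) (w' : ℤ → E3), IsStacked a b w' → LinearIndependent ℝ ![a, b] → ‖a‖ ≤ Λ₁ → ‖b‖ ≤ Λ₁ →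
    IsSep δ (Layered a b w') → IsCleanW (μS (Layered a b w')) → (∀ m : ℤ, gapStress a b m (incr w') = 0) →
    UniformlyClean (Layered a b w') → B a b w' → TubeConvexData a b w' ρ

/-- 7c♭‴ ON THE BOX FAMILY `B`: tube uniqueness round every reference of record that satisfies `B a b w'`. -/
def TubeUniquenessRefBox (Λ₁ ρ : ℝ) (B : E3 → E3 → (ℤ → E3) → Prop) : Prop :=
  ∀ δ : ℝ, 0 < δ → ∀ (a b : E3) (w' : ℤ → E3), IsStacked a b w' → LinearIndependent ℝ ![a, b] → ‖a‖ ≤ Λ₁ → ‖b‖ ≤ Λ₁ →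
    IsSep δ (Layered a b w') → IsCleanW (μS (Layered a b w')) → (∀ m : ℤ, gapStress a b m (incr w') = 0) →
    UniformlyClean (Layered a b w') → B a b w' →
    ∀ w : ℤ → E3, IsStacked a b w → (∀ m : ℤ, incr w m ∈ tube w' ρ m) → (∀ m : ℤ, gapStress a b m (incr w) = 0) → incr w = incr w'

/-- ★ the seam on the box family: `TubeConvexRefBox Λ₁ ρ B → TubeUniquenessRefBox Λ₁ ρ B`. -/
theorem tubeUniquenessRefBox_of_convex {Λ₁ ρ : ℝ} {B : E3 → E3 → (ℤ → E3) → Prop} (hT : TubeConvexRefBox Λ₁ ρ B) :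
    TubeUniquenessRefBox Λ₁ ρ B := by
  intro δ hδ a b w' hst' hab ha hb hsep hcl hzero' hUC hBx w _hst htube hzero
  exact (incr_eq_of_tubeConvex (hT δ hδ a b w' hst' hab ha hb hsep hcl hzero' hUC hBx) htube (fun m => by rw [hzero m, hzero' m])).symm

/-- LEAF CHᴬ-Ref-T on the box family `B`. -/
def AdjacentChannelRefTBox (Λ₁ ρ : ℝ) (B : E3 → E3 → (ℤ → E3) → Prop) (lT lN : ℝ) : Prop :=
  ∀ δ : ℝ, 0 < δ → ∀ (a b : E3) (w' : ℤ → E3), IsStacked a b w' → LinearIndependent ℝ ![a, b] → ‖a‖ ≤ Λ₁ → ‖b‖ ≤ Λ₁ →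
    IsSep δ (Layered a b w') → IsCleanW (μS (Layered a b w')) → (∀ m : ℤ, gapStress a b m (incr w') = 0) →
    UniformlyClean (Layered a b w') → B a b w' → 95 / 289 * ‖a‖ ^ 2 ≤ |⟪a, b⟫| →
    ∀ ν : E3, ‖ν‖ = 1 → ⟪ν, a⟫ = 0 → ⟪ν, b⟫ = 0 → IsAdjacentChannelMono a b w' ρ ν lT lN

/-- LEAF CHᴬ-Ref-S on the box family `B`. -/
def AdjacentChannelRefSBox (Λ₁ ρ : ℝ) (B : E3 → E3 → (ℤ → E3) → Prop) (lT lN : ℝ) : Prop :=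
  ∀ δ : ℝ, 0 < δ → ∀ (a b : E3) (w' : ℤ → E3), IsStacked a b w' → LinearIndependent ℝ ![a, b] → ‖a‖ ≤ Λ₁ → ‖b‖ ≤ Λ₁ →
    IsSep δ (Layered a b w') → IsCleanW (μS (Layered a b w')) → (∀ m : ℤ, gapStress a b m (incr w') = 0) →
    UniformlyClean (Layered a b w') → B a b w' → |⟪a, b⟫| ≤ 11 / 75 * ‖a‖ ^ 2 →
    ∀ ν : E3, ‖ν‖ = 1 → ⟪ν, a⟫ = 0 → ⟪ν, b⟫ = 0 → IsAdjacentChannelMono a b w' ρ ν lT lN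

/-- LEAF CHꜰ-Ref-T below `s₀` on the box family `B`. -/
def FarChannelBelowRefTBox (Λ₁ ρ : ℝ) (B : E3 → E3 → (ℤ → E3) → Prop) (μT μN : ℕ → ℝ) (s₀ : ℕ) : Prop :=
  ∀ δ : ℝ, 0 < δ → ∀ (a b : E3) (w' : ℤ → E3), IsStacked a b w' → LinearIndependent ℝ ![a, b] → ‖a‖ ≤ Λ₁ → ‖b‖ ≤ Λ₁ →
    IsSep δ (Layered a b w') → IsCleanW (μS (Layered a b w')) → (∀ m : ℤ, gapStress a b m (incr w') = 0) →
    UniformlyClean (Layered a b w') → B a b w' → 95 / 289 * ‖a‖ ^ 2 ≤ |⟪a, b⟫| →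
    ∀ ν : E3, ‖ν‖ = 1 → ⟪ν, a⟫ = 0 → ⟪ν, b⟫ = 0 → IsFarChannelModulusBelow a b w' ρ ν μT μN s₀

/-- LEAF CHꜰ-Ref-S below `s₀` on the box family `B`. -/
def FarChannelBelowRefSBox (Λ₁ ρ : ℝ) (B : E3 → E3 → (ℤ → E3) → Prop) (μT μN : ℕ → ℝ) (s₀ : ℕ) : Prop :=
  ∀ δ : ℝ, 0 < δ → ∀ (a b : E3) (w' : ℤ → E3), IsStacked a b w' → LinearIndependent ℝ ![a, b] → ‖a‖ ≤ Λ₁ → ‖b‖ ≤ Λ₁ →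
    IsSep δ (Layered a b w') → IsCleanW (μS (Layered a b w')) → (∀ m : ℤ, gapStress a b m (incr w') = 0) →
    UniformlyClean (Layered a b w') → B a b w' → |⟪a, b⟫| ≤ 11 / 75 * ‖a‖ ^ 2 →
    ∀ ν : E3, ‖ν‖ = 1 → ⟪ν, a⟫ = 0 → ⟪ν, b⟫ = 0 → IsFarChannelModulusBelow a b w' ρ ν μT μN s₀

/-! ### Monotonicity in the box and recovery of the statements of record (`B := ⊤`) -/

/-- `tubeConvexRefBox_mono` — monotonicity in the box predicate (formal bookkeeping). [folklore] -/
theorem tubeConvexRefBox_mono {Λ₁ ρ : ℝ} {B B' : E3 → E3 → (ℤ → E3) → Prop} (hBB' : ∀ a b w', B a b w' → B' a b w')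
    (h : TubeConvexRefBox Λ₁ ρ B') : TubeConvexRefBox Λ₁ ρ B :=
  fun δ hδ a b w' hst hab ha hb hs hc hz hUC hBx => h δ hδ a b w' hst hab ha hb hs hc hz hUC (hBB' a b w' hBx)

/-- `tubeUniquenessRefBox_mono` — monotonicity in the box predicate (formal bookkeeping). [folklore] -/
theorem tubeUniquenessRefBox_mono {Λ₁ ρ : ℝ} {B B' : E3 → E3 → (ℤ → E3) → Prop} (hBB' : ∀ a b w', B a b w' → B' a b w')
    (h : TubeUniquenessRefBox Λ₁ ρ B') : TubeUniquenessRefBox Λ₁ ρ B :=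
  fun δ hδ a b w' hst hab ha hb hs hc hz hUC hBx => h δ hδ a b w' hst hab ha hb hs hc hz hUC (hBB' a b w' hBx)

/-- `adjacentChannelRefTBox_mono` — monotonicity in the box predicate (formal bookkeeping). [folklore] -/
theorem adjacentChannelRefTBox_mono {Λ₁ ρ lT lN : ℝ} {B B' : E3 → E3 → (ℤ → E3) → Prop} (hBB' : ∀ a b w', B a b w' → B' a b w')
    (h : AdjacentChannelRefTBox Λ₁ ρ B' lT lN) : AdjacentChannelRefTBox Λ₁ ρ B lT lN :=
  fun δ hδ a b w' hst hab ha hb hs hc hz hUC hBx => h δ hδ a b w' hst hab ha hb hs hc hz hUC (hBB' a b w' hBx)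

/-- `adjacentChannelRefSBox_mono` — monotonicity in the box predicate (formal bookkeeping). [folklore] -/
theorem adjacentChannelRefSBox_mono {Λ₁ ρ lT lN : ℝ} {B B' : E3 → E3 → (ℤ → E3) → Prop} (hBB' : ∀ a b w', B a b w' → B' a b w')
    (h : AdjacentChannelRefSBox Λ₁ ρ B' lT lN) : AdjacentChannelRefSBox Λ₁ ρ B lT lN :=
  fun δ hδ a b w' hst hab ha hb hs hc hz hUC hBx => h δ hδ a b w' hst hab ha hb hs hc hz hUC (hBB' a b w' hBx)

/-- `farChannelBelowRefTBox_mono` — monotonicity in the box predicate (formal bookkeeping). [folklore] -/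
theorem farChannelBelowRefTBox_mono {Λ₁ ρ : ℝ} {μT μN : ℕ → ℝ} {s₀ : ℕ} {B B' : E3 → E3 → (ℤ → E3) → Prop}
    (hBB' : ∀ a b w', B a b w' → B' a b w') (h : FarChannelBelowRefTBox Λ₁ ρ B' μT μN s₀) : FarChannelBelowRefTBox Λ₁ ρ B μT μN s₀ :=
  fun δ hδ a b w' hst hab ha hb hs hc hz hUC hBx => h δ hδ a b w' hst hab ha hb hs hc hz hUC (hBB' a b w' hBx)

/-- `farChannelBelowRefSBox_mono` — monotonicity in the box predicate (formal bookkeeping). [folklore] -/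
theorem farChannelBelowRefSBox_mono {Λ₁ ρ : ℝ} {μT μN : ℕ → ℝ} {s₀ : ℕ} {B B' : E3 → E3 → (ℤ → E3) → Prop}
    (hBB' : ∀ a b w', B a b w' → B' a b w') (h : FarChannelBelowRefSBox Λ₁ ρ B' μT μN s₀) : FarChannelBelowRefSBox Λ₁ ρ B μT μN s₀ :=
  fun δ hδ a b w' hst hab ha hb hs hc hz hUC hBx => h δ hδ a b w' hst hab ha hb hs hc hz hUC (hBB' a b w' hBx)

/-- the statement of record feeds every box. -/
theorem tubeConvexRefBox_of_ref {Λ₁ ρ : ℝ} {B : E3 → E3 → (ℤ → E3) → Prop} (h : TubeConvexRef Λ₁ ρ) : TubeConvexRefBox Λ₁ ρ B :=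
  fun δ hδ a b w' hst hab ha hb hs hc hz hUC _ => h δ hδ a b w' hst hab ha hb hs hc hz hUC

/-- recovery: the box `⊤` is the statement of record. -/
theorem tubeConvexRef_of_box_top {Λ₁ ρ : ℝ} (h : TubeConvexRefBox Λ₁ ρ fun _ _ _ => True) : TubeConvexRef Λ₁ ρ :=
  fun δ hδ a b w' hst hab ha hb hs hc hz hUC => h δ hδ a b w' hst hab ha hb hs hc hz hUC trivial

/-- `tubeUniquenessRefBox_of_ref` — recovery / transfer between the boxed and the record statements (formal bookkeeping). [folklore] -/
theorem tubeUniquenessRefBox_of_ref {Λ₁ ρ : ℝ} {B : E3 → E3 → (ℤ → E3) → Prop} (h : TubeUniquenessRef Λ₁ ρ) :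
    TubeUniquenessRefBox Λ₁ ρ B :=
  fun δ hδ a b w' hst hab ha hb hs hc hz hUC _ => h δ hδ a b w' hst hab ha hb hs hc hz hUC

/-- `tubeUniquenessRef_of_box_top` — recovery / transfer between the boxed and the record statements (formal bookkeeping). [folklore] -/
theorem tubeUniquenessRef_of_box_top {Λ₁ ρ : ℝ} (h : TubeUniquenessRefBox Λ₁ ρ fun _ _ _ => True) : TubeUniquenessRef Λ₁ ρ :=
  fun δ hδ a b w' hst hab ha hb hs hc hz hUC => h δ hδ a b w' hst hab ha hb hs hc hz hUC trivial

/-- `adjacentChannelRefTBox_of_refT` — recovery / transfer between the boxed and the record statements (formal bookkeeping). [folklore] -/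
theorem adjacentChannelRefTBox_of_refT {Λ₁ ρ lT lN : ℝ} {B : E3 → E3 → (ℤ → E3) → Prop} (h : AdjacentChannelRefT Λ₁ ρ lT lN) :
    AdjacentChannelRefTBox Λ₁ ρ B lT lN :=
  fun δ hδ a b w' hst hab ha hb hs hc hz hUC _ => h δ hδ a b w' hst hab ha hb hs hc hz hUC

/-- `adjacentChannelRefSBox_of_refS` — recovery / transfer between the boxed and the record statements (formal bookkeeping). [folklore] -/
theorem adjacentChannelRefSBox_of_refS {Λ₁ ρ lT lN : ℝ} {B : E3 → E3 → (ℤ → E3) → Prop} (h : AdjacentChannelRefS Λ₁ ρ lT lN) :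
    AdjacentChannelRefSBox Λ₁ ρ B lT lN :=
  fun δ hδ a b w' hst hab ha hb hs hc hz hUC _ => h δ hδ a b w' hst hab ha hb hs hc hz hUC

/-- `farChannelBelowRefTBox_of_refT` — recovery / transfer between the boxed and the record statements (formal bookkeeping). [folklore] -/
theorem farChannelBelowRefTBox_of_refT {Λ₁ ρ : ℝ} {μT μN : ℕ → ℝ} {s₀ : ℕ} {B : E3 → E3 → (ℤ → E3) → Prop}
    (h : FarChannelBelowRefT Λ₁ ρ μT μN s₀) : FarChannelBelowRefTBox Λ₁ ρ B μT μN s₀ :=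
  fun δ hδ a b w' hst hab ha hb hs hc hz hUC _ => h δ hδ a b w' hst hab ha hb hs hc hz hUC

/-- `farChannelBelowRefSBox_of_refS` — recovery / transfer between the boxed and the record statements (formal bookkeeping). [folklore] -/
theorem farChannelBelowRefSBox_of_refS {Λ₁ ρ : ℝ} {μT μN : ℕ → ℝ} {s₀ : ℕ} {B : E3 → E3 → (ℤ → E3) → Prop}
    (h : FarChannelBelowRefS Λ₁ ρ μT μN s₀) : FarChannelBelowRefSBox Λ₁ ρ B μT μN s₀ :=
  fun δ hδ a b w' hst hab ha hb hs hc hz hUC _ => h δ hδ a b w' hst hab ha hb hs hc hz hUC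

/-! ## §3 The consumers of record with the box threaded (proofs verbatim from `…PairModulusSharp` §6) -/

/-- ★★ 7c‴ ON THE BOX FAMILY from the per-branch box-restricted certificate leaves with per-branch sharp tail budgets (floor `73/100` on the
triangular branch, `31/50` on the square branch; the tail leaf is PROVED on the full family, so it needs no box). -/
theorem tubeConvexRefBox_record_of_branch_certs_sharp {B : E3 → E3 → (ℤ → E3) → Prop} {lT lN lam B₁T B₁N ε : ℝ} {μT μN : ℕ → ℝ}
    {s₀ : ℕ} (hAT : AdjacentChannelRefTBox (17 / 16) (1 / 40) B lT lN) (hBT : FarChannelBelowRefTBox (17 / 16) (1 / 40) B μT μN s₀)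
    (hs₀ : 2 ≤ s₀) (hε : 0 < ε) (hΘ : 0 < thetaSq (73 / 100 - 1 / 40) (1 / 40) (23 / 25) ε s₀) (hμT : ∀ s, 0 ≤ μT s) (hμN : ∀ s, 0 ≤ μN s)
    (h₁T : ∑ s ∈ Finset.Ico 2 s₀, ((s : ℕ) : ℝ) ^ 2 * μT s ≤ B₁T) (h₁N : ∑ s ∈ Finset.Ico 2 s₀, ((s : ℕ) : ℝ) ^ 2 * μN s ≤ B₁N)
    (hlam : 0 < lam)
    (hlamT : lam + (B₁T + sharpConst (73 / 100) (73 / 100 - 1 / 40) (1 / 40) (23 / 25) ε s₀ / (3 * (((s₀ : ℕ) : ℝ) - 1) ^ 3)) ≤ lT)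
    (hlamN : lam + (B₁N + sharpConst (73 / 100) (73 / 100 - 1 / 40) (1 / 40) (23 / 25) ε s₀ / (3 * (((s₀ : ℕ) : ℝ) - 1) ^ 3)) ≤ lN)
    {lT' lN' lam' B₁T' B₁N' ε' : ℝ} {μT' μN' : ℕ → ℝ} {s₀' : ℕ}
    (hAS : AdjacentChannelRefSBox (17 / 16) (1 / 40) B lT' lN') (hBS : FarChannelBelowRefSBox (17 / 16) (1 / 40) B μT' μN' s₀')
    (hs₀' : 2 ≤ s₀') (hε' : 0 < ε') (hΘ' : 0 < thetaSq (31 / 50 - 1 / 40) (1 / 40) (23 / 25) ε' s₀') (hμT' : ∀ s, 0 ≤ μT' s)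
    (hμN' : ∀ s, 0 ≤ μN' s) (h₁T' : ∑ s ∈ Finset.Ico 2 s₀', ((s : ℕ) : ℝ) ^ 2 * μT' s ≤ B₁T')
    (h₁N' : ∑ s ∈ Finset.Ico 2 s₀', ((s : ℕ) : ℝ) ^ 2 * μN' s ≤ B₁N') (hlam' : 0 < lam')
    (hlamT' : lam' + (B₁T' + tailBudget ε' s₀') ≤ lT') (hlamN' : lam' + (B₁N' + tailBudget ε' s₀') ≤ lN') :
    TubeConvexRefBox (17 / 16) (1 / 40) B := by
  intro δ hδ a b w' hst hab ha hb hs hc hz hUC hBx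
  refine tubeConvexData_of_channelData hδ hst hab ha hb hs hc (by norm_num) ?_
  obtain ⟨ν, a', hν, hνa, hνb, ha'lo, -, ⟨halo, hahi⟩, ⟨-, hbhi⟩, -, hTS', hpS, -, hfloor, hfloorT⟩ :=
    cleanStackedWindows hst hab ha hb hUC
  obtain ⟨ν₀, -, -, -, -, -, -, -, hTS⟩ := stackedUniform (aHi := 103 / 100) (by norm_num) hδ hs hc hst ha hb
  rcases hTS with ⟨hT, -⟩ | ⟨hS, -⟩
  · -- triangular branch: the cell is near-triangular, floor `39a′/50 ≥ 73/100`
    have hmin : min ‖a - b‖ ‖a + b‖ ≤ a' * (51 / 50) := by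
      rcases hTS' with h | h
      · exact h
      · exfalso
        have hp := hpS h
        have hxhi : ‖a‖ ^ 2 ≤ (a' * (51 / 50)) ^ 2 := pow_le_pow_left₀ (norm_nonneg _) hahi 2
        have hyhi : ‖b‖ ^ 2 ≤ (a' * (51 / 50)) ^ 2 := pow_le_pow_left₀ (norm_nonneg _) hbhi 2
        have hxlo : (a' * (49 / 50)) ^ 2 ≤ ‖a‖ ^ 2 := pow_le_pow_left₀ (by linarith) halo 2
        nlinarith [mul_pos (by linarith : (0 : ℝ) < a') (by linarith : (0 : ℝ) < a')]
    have hw : ∀ i, (73 / 100 : ℝ) ≤ ⟪ν, incr w' i⟫ := fun i => by linarith [hfloorT hmin i]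
    obtain ⟨τ, hτ0, hτB, hPM⟩ := exists_tail_of_floor hst hab ha hb hUC hν hνa hνb hw (by norm_num) hε hs₀ hΘ
    exact tubeChannelData_of_certs hν (hAT δ hδ a b w' hst hab ha hb hs hc hz hUC hBx hT ν hν hνa hνb)
      (hBT δ hδ a b w' hst hab ha hb hs hc hz hUC hBx hT ν hν hνa hνb) hPM hμT hμN hτ0 h₁T h₁N hτB hlam hlamT hlamN
  · -- square branch: the universal floor `33a′/50 ≥ 31/50`
    have hw : ∀ i, (31 / 50 : ℝ) ≤ ⟪ν, incr w' i⟫ := fun i => by linarith [hfloor i]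
    obtain ⟨τ, hτ0, hτB, hPM⟩ := exists_tail_of_floor hst hab ha hb hUC hν hνa hνb hw (by norm_num) hε' hs₀' hΘ'
    exact tubeChannelData_of_certs hν (hAS δ hδ a b w' hst hab ha hb hs hc hz hUC hBx hS ν hν hνa hνb)
      (hBS δ hδ a b w' hst hab ha hb hs hc hz hUC hBx hS ν hν hνa hνb) hPM hμT' hμN' hτ0 h₁T' h₁N' hτB hlam' hlamT' hlamN'

/-- ★★★ 7c‴ ON THE BOX FAMILY at `s₀ = s₀′ = 6` with the numerical per-branch tail budgets `7/10` (T) and `9/4` (S). -/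
theorem tubeConvexRefBox_record_of_branch_certs₆ {B : E3 → E3 → (ℤ → E3) → Prop} {lT lN lam B₁T B₁N : ℝ} {μT μN : ℕ → ℝ}
    (hAT : AdjacentChannelRefTBox (17 / 16) (1 / 40) B lT lN) (hBT : FarChannelBelowRefTBox (17 / 16) (1 / 40) B μT μN 6)
    (hμT : ∀ s, 0 ≤ μT s) (hμN : ∀ s, 0 ≤ μN s)
    (h₁T : ∑ s ∈ Finset.Ico 2 6, ((s : ℕ) : ℝ) ^ 2 * μT s ≤ B₁T) (h₁N : ∑ s ∈ Finset.Ico 2 6, ((s : ℕ) : ℝ) ^ 2 * μN s ≤ B₁N)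
    (hlam : 0 < lam) (hlamT : lam + (B₁T + 7 / 10) ≤ lT) (hlamN : lam + (B₁N + 7 / 10) ≤ lN)
    {lT' lN' lam' B₁T' B₁N' : ℝ} {μT' μN' : ℕ → ℝ}
    (hAS : AdjacentChannelRefSBox (17 / 16) (1 / 40) B lT' lN') (hBS : FarChannelBelowRefSBox (17 / 16) (1 / 40) B μT' μN' 6)
    (hμT' : ∀ s, 0 ≤ μT' s) (hμN' : ∀ s, 0 ≤ μN' s)
    (h₁T' : ∑ s ∈ Finset.Ico 2 6, ((s : ℕ) : ℝ) ^ 2 * μT' s ≤ B₁T') (h₁N' : ∑ s ∈ Finset.Ico 2 6, ((s : ℕ) : ℝ) ^ 2 * μN' s ≤ B₁N')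
    (hlam' : 0 < lam') (hlamT' : lam' + (B₁T' + 9 / 4) ≤ lT') (hlamN' : lam' + (B₁N' + 9 / 4) ≤ lN') :
    TubeConvexRefBox (17 / 16) (1 / 40) B := by
  have hΘ : 0 < thetaSq (73 / 100 - 1 / 40) (1 / 40) (23 / 25) (7 / 10) 6 := by unfold thetaSq; norm_num
  have hΘ' : 0 < thetaSq (31 / 50 - 1 / 40) (1 / 40) (23 / 25) (17 / 20) 6 := by unfold thetaSq; norm_num
  have hπ := Real.pi_lt_d2
  have hπ0 := Real.pi_pos
  have hbT : sharpConst (73 / 100) (73 / 100 - 1 / 40) (1 / 40) (23 / 25) (7 / 10) 6 / (3 * (((6 : ℕ) : ℝ) - 1) ^ 3) ≤ 7 / 10 := by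
    unfold sharpConst thetaSq
    norm_num
    nlinarith
  have hbS : tailBudget (17 / 20) 6 ≤ 9 / 4 := by
    unfold tailBudget sharpConst thetaSq
    norm_num
    nlinarith
  exact tubeConvexRefBox_record_of_branch_certs_sharp hAT hBT (by norm_num) (by norm_num) hΘ hμT hμN h₁T h₁N hlam (by linarith)
    (by linarith) hAS hBS (by norm_num) (by norm_num) hΘ' hμT' hμN' h₁T' h₁N' hlam' (by linarith) (by linarith)

/-! ## §4 Hessian certificates with a configuration predicate `Ψ a b w'` and the ingestion on the box family -/

/-- HESSIAN CERTIFICATE, adjacent windows, configuration predicate `Ψ a b w'` (e.g. `B a b w' ∧ PhiT a b`). -/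
def HessCertAdjBox (Ψ : E3 → E3 → (ℤ → E3) → Prop) (αT αN γ : ℝ) : Prop :=
  ∀ δ : ℝ, 0 < δ → ∀ (a b : E3) (w' : ℤ → E3), IsStacked a b w' → LinearIndependent ℝ ![a, b] → ‖a‖ ≤ 17 / 16 → ‖b‖ ≤ 17 / 16 →
    IsSep δ (Layered a b w') → IsCleanW (μS (Layered a b w')) → (∀ m : ℤ, gapStress a b m (incr w') = 0) →
    UniformlyClean (Layered a b w') → Ψ a b w' →
    ∀ ν : E3, ‖ν‖ = 1 → ⟪ν, a⟫ = 0 → ⟪ν, b⟫ = 0 → ∀ m : ℤ, ∀ x ∈ tube w' (1 / 40) m, ∀ D : E3,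
      αT * ‖tng ν D‖ ^ 2 + αN * ⟪ν, D⟫ ^ 2 - 2 * γ * (‖tng ν D‖ * |⟪ν, D⟫|) ≤ ⟪hess a b x D, D⟫

/-- HESSIAN CERTIFICATE, span windows `2 ≤ s < s₀`, configuration predicate `Ψ a b w'`. -/
def HessCertFarBox (Ψ : E3 → E3 → (ℤ → E3) → Prop) (αT αN γ : ℕ → ℝ) (s₀ : ℕ) : Prop :=
  ∀ δ : ℝ, 0 < δ → ∀ (a b : E3) (w' : ℤ → E3), IsStacked a b w' → LinearIndependent ℝ ![a, b] → ‖a‖ ≤ 17 / 16 → ‖b‖ ≤ 17 / 16 →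
    IsSep δ (Layered a b w') → IsCleanW (μS (Layered a b w')) → (∀ m : ℤ, gapStress a b m (incr w') = 0) →
    UniformlyClean (Layered a b w') → Ψ a b w' →
    ∀ ν : E3, ‖ν‖ = 1 → ⟪ν, a⟫ = 0 → ⟪ν, b⟫ = 0 →
    ∀ k l : ℤ, k + 2 ≤ l → (l - k).toNat < s₀ → ∀ x ∈ closedBall (w' l - w' k) ((l - k).toNat * (1 / 40 : ℝ)), ∀ D : E3,
      -(αT (l - k).toNat) * ‖tng ν D‖ ^ 2 + -(αN (l - k).toNat) * ⟪ν, D⟫ ^ 2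
        - 2 * γ (l - k).toNat * (‖tng ν D‖ * |⟪ν, D⟫|) ≤ ⟪hess a b x D, D⟫

/-- `hessCertAdjBox_mono` — monotonicity in the box predicate (formal bookkeeping). [folklore] -/
theorem hessCertAdjBox_mono {Ψ Ψ' : E3 → E3 → (ℤ → E3) → Prop} {αT αN γ : ℝ} (hΨ : ∀ a b w', Ψ a b w' → Ψ' a b w')
    (h : HessCertAdjBox Ψ' αT αN γ) : HessCertAdjBox Ψ αT αN γ :=
  fun δ hδ a b w' hst hab ha hb hs hc hg hUC hx => h δ hδ a b w' hst hab ha hb hs hc hg hUC (hΨ a b w' hx)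

/-- `hessCertFarBox_mono` — monotonicity in the box predicate (formal bookkeeping). [folklore] -/
theorem hessCertFarBox_mono {Ψ Ψ' : E3 → E3 → (ℤ → E3) → Prop} {αT αN γ : ℕ → ℝ} {s₀ : ℕ} (hΨ : ∀ a b w', Ψ a b w' → Ψ' a b w')
    (h : HessCertFarBox Ψ' αT αN γ s₀) : HessCertFarBox Ψ αT αN γ s₀ :=
  fun δ hδ a b w' hst hab ha hb hs hc hg hUC hx => h δ hδ a b w' hst hab ha hb hs hc hg hUC (hΨ a b w' hx)

/-- the certificates of record are the box certificates of the `w'`-independent predicate. -/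
theorem hessCertAdjBox_of_adj {Φ : E3 → E3 → Prop} {αT αN γ : ℝ} (h : HessCertAdj Φ αT αN γ) :
    HessCertAdjBox (fun a b _ => Φ a b) αT αN γ :=
  fun δ hδ a b w' hst hab ha hb hs hc hg hUC hx => h δ hδ a b w' hst hab ha hb hs hc hg hUC hx

/-- `hessCertFarBox_of_far` — recovery / transfer between the boxed and the record statements (formal bookkeeping). [folklore] -/
theorem hessCertFarBox_of_far {Φ : E3 → E3 → Prop} {αT αN γ : ℕ → ℝ} {s₀ : ℕ} (h : HessCertFar Φ αT αN γ s₀) :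
    HessCertFarBox (fun a b _ => Φ a b) αT αN γ s₀ :=
  fun δ hδ a b w' hst hab ha hb hs hc hg hUC hx => h δ hδ a b w' hst hab ha hb hs hc hg hUC hx

/-- ★ CHᴬ-Ref-T on the box family from an adjacent Hessian certificate on `B ∧ PhiT`. -/
theorem adjacentChannelRefTBox_of_hess {B : E3 → E3 → (ℤ → E3) → Prop} {αT αN γ θ lT lN : ℝ}
    (hC : HessCertAdjBox (fun a b w' => B a b w' ∧ PhiT a b) αT αN γ) (hθ : 0 < θ) (hγ : 0 ≤ γ) (hlT : lT ≤ αT - θ * γ)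
    (hlN : lN ≤ αN - γ / θ) : AdjacentChannelRefTBox (17 / 16) (1 / 40) B lT lN :=
  fun δ hδ a b w' hst hab ha hb hs hc hg hUC hBx hT ν hν hνa hνb =>
    isAdjacentChannelMono_of_hess hst hab ha hb hUC (hC δ hδ a b w' hst hab ha hb hs hc hg hUC ⟨hBx, hT⟩ ν hν hνa hνb) hθ hγ hlT hlN

/-- ★ CHᴬ-Ref-S on the box family from an adjacent Hessian certificate on `B ∧ PhiS`. -/
theorem adjacentChannelRefSBox_of_hess {B : E3 → E3 → (ℤ → E3) → Prop} {αT αN γ θ lT lN : ℝ}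
    (hC : HessCertAdjBox (fun a b w' => B a b w' ∧ PhiS a b) αT αN γ) (hθ : 0 < θ) (hγ : 0 ≤ γ) (hlT : lT ≤ αT - θ * γ)
    (hlN : lN ≤ αN - γ / θ) : AdjacentChannelRefSBox (17 / 16) (1 / 40) B lT lN :=
  fun δ hδ a b w' hst hab ha hb hs hc hg hUC hBx hS ν hν hνa hνb =>
    isAdjacentChannelMono_of_hess hst hab ha hb hUC (hC δ hδ a b w' hst hab ha hb hs hc hg hUC ⟨hBx, hS⟩ ν hν hνa hνb) hθ hγ hlT hlN

/-- ★ CHꜰ-Ref-T below `s₀` on the box family from a span Hessian certificate on `B ∧ PhiT`. -/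
theorem farChannelBelowRefTBox_of_hess {B : E3 → E3 → (ℤ → E3) → Prop} {αT αN γ θ μT μN : ℕ → ℝ} {s₀ : ℕ}
    (hC : HessCertFarBox (fun a b w' => B a b w' ∧ PhiT a b) αT αN γ s₀) (hθ : ∀ s, 0 < θ s) (hγ : ∀ s, 0 ≤ γ s)
    (hμT : ∀ s, αT s + θ s * γ s ≤ μT s) (hμN : ∀ s, αN s + γ s / θ s ≤ μN s) :
    FarChannelBelowRefTBox (17 / 16) (1 / 40) B μT μN s₀ :=
  fun δ hδ a b w' hst hab ha hb hs hc hg hUC hBx hT ν hν hνa hνb =>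
    isFarChannelModulusBelow_of_hess hst hab ha hb hUC (hC δ hδ a b w' hst hab ha hb hs hc hg hUC ⟨hBx, hT⟩ ν hν hνa hνb) hθ hγ hμT hμN

/-- ★ CHꜰ-Ref-S below `s₀` on the box family from a span Hessian certificate on `B ∧ PhiS`. -/
theorem farChannelBelowRefSBox_of_hess {B : E3 → E3 → (ℤ → E3) → Prop} {αT αN γ θ μT μN : ℕ → ℝ} {s₀ : ℕ}
    (hC : HessCertFarBox (fun a b w' => B a b w' ∧ PhiS a b) αT αN γ s₀) (hθ : ∀ s, 0 < θ s) (hγ : ∀ s, 0 ≤ γ s)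
    (hμT : ∀ s, αT s + θ s * γ s ≤ μT s) (hμN : ∀ s, αN s + γ s / θ s ≤ μN s) :
    FarChannelBelowRefSBox (17 / 16) (1 / 40) B μT μN s₀ :=
  fun δ hδ a b w' hst hab ha hb hs hc hg hUC hBx hS ν hν hνa hνb =>
    isFarChannelModulusBelow_of_hess hst hab ha hb hUC (hC δ hδ a b w' hst hab ha hb hs hc hg hUC ⟨hBx, hS⟩ ν hν hνa hνb) hθ hγ hμT hμN

/-- ★★★ INGESTION ON THE BOX FAMILY: four Hessian certificates on `B ∧ PhiT` / `B ∧ PhiS` (adjacent and span `2..5`), weights and the closing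
arithmetic give `TubeConvexRefBox (17/16) (1/40) B`. -/
theorem tubeConvexRefBox_of_hessCerts₆ {B : E3 → E3 → (ℤ → E3) → Prop} {αT αN γ θ lT lN lam B₁T B₁N : ℝ}
    {αTf αNf γf θf μT μN : ℕ → ℝ}
    (hA : HessCertAdjBox (fun a b w' => B a b w' ∧ PhiT a b) αT αN γ) (hθ : 0 < θ) (hγ : 0 ≤ γ) (hlT : lT ≤ αT - θ * γ)
    (hlN : lN ≤ αN - γ / θ) (hF : HessCertFarBox (fun a b w' => B a b w' ∧ PhiT a b) αTf αNf γf 6) (hθf : ∀ s, 0 < θf s)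
    (hγf : ∀ s, 0 ≤ γf s) (hμTf : ∀ s, αTf s + θf s * γf s ≤ μT s) (hμNf : ∀ s, αNf s + γf s / θf s ≤ μN s) (hμT : ∀ s, 0 ≤ μT s)
    (hμN : ∀ s, 0 ≤ μN s) (h₁T : ∑ s ∈ Finset.Ico 2 6, ((s : ℕ) : ℝ) ^ 2 * μT s ≤ B₁T)
    (h₁N : ∑ s ∈ Finset.Ico 2 6, ((s : ℕ) : ℝ) ^ 2 * μN s ≤ B₁N) (hlam : 0 < lam) (hlamT : lam + (B₁T + 7 / 10) ≤ lT)
    (hlamN : lam + (B₁N + 7 / 10) ≤ lN)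
    {αT' αN' γ' θ' lT' lN' lam' B₁T' B₁N' : ℝ} {αTf' αNf' γf' θf' μT' μN' : ℕ → ℝ}
    (hA' : HessCertAdjBox (fun a b w' => B a b w' ∧ PhiS a b) αT' αN' γ') (hθ' : 0 < θ') (hγ' : 0 ≤ γ') (hlT' : lT' ≤ αT' - θ' * γ')
    (hlN' : lN' ≤ αN' - γ' / θ') (hF' : HessCertFarBox (fun a b w' => B a b w' ∧ PhiS a b) αTf' αNf' γf' 6) (hθf' : ∀ s, 0 < θf' s)
    (hγf' : ∀ s, 0 ≤ γf' s) (hμTf' : ∀ s, αTf' s + θf' s * γf' s ≤ μT' s) (hμNf' : ∀ s, αNf' s + γf' s / θf' s ≤ μN' s)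
    (hμT' : ∀ s, 0 ≤ μT' s) (hμN' : ∀ s, 0 ≤ μN' s) (h₁T' : ∑ s ∈ Finset.Ico 2 6, ((s : ℕ) : ℝ) ^ 2 * μT' s ≤ B₁T')
    (h₁N' : ∑ s ∈ Finset.Ico 2 6, ((s : ℕ) : ℝ) ^ 2 * μN' s ≤ B₁N') (hlam' : 0 < lam') (hlamT' : lam' + (B₁T' + 9 / 4) ≤ lT')
    (hlamN' : lam' + (B₁N' + 9 / 4) ≤ lN') : TubeConvexRefBox (17 / 16) (1 / 40) B :=
  tubeConvexRefBox_record_of_branch_certs₆ (adjacentChannelRefTBox_of_hess hA hθ hγ hlT hlN)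
    (farChannelBelowRefTBox_of_hess hF hθf hγf hμTf hμNf) hμT hμN h₁T h₁N hlam hlamT hlamN
    (adjacentChannelRefSBox_of_hess hA' hθ' hγ' hlT' hlN') (farChannelBelowRefSBox_of_hess hF' hθf' hγf' hμTf' hμNf') hμT' hμN' h₁T'
    h₁N' hlam' hlamT' hlamN'

/-! ## §5 The C182 endpoints on the box family (constants of `…ChannelCertC182` verbatim) -/

/-- ★★★ LEAF-LEVEL CLOSING ON THE BOX FAMILY with the C182 §R1 literals. -/
theorem tubeConvexRefBox_of_leafCerts_C182 {B : E3 → E3 → (ℤ → E3) → Prop}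
    (hAT : AdjacentChannelRefTBox (17 / 16) (1 / 40) B (17 / 10) (43 / 10)) (hBT : FarChannelBelowRefTBox (17 / 16) (1 / 40) B muT muN 6)
    (hAS : AdjacentChannelRefSBox (17 / 16) (1 / 40) B (317 / 100) (401 / 50))
    (hBS : FarChannelBelowRefSBox (17 / 16) (1 / 40) B muT' muN' 6) : TubeConvexRefBox (17 / 16) (1 / 40) B :=
  tubeConvexRefBox_record_of_branch_certs₆ hAT hBT muT_nonneg muN_nonneg sum_muT.le sum_muN.le (lam := 23 / 25) (by norm_num)
    (by norm_num) (by norm_num) hAS hBS muT'_nonneg muN'_nonneg sum_muT'.le sum_muN'.le (lam' := 4 / 5) (by norm_num) (by norm_num)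
    (by norm_num)

/-- ★★★ HESSIAN-LEVEL CLOSING ON THE BOX FAMILY with the C182 §R1 block bounds and weights `θ = 7/25, θ_f = 1/5` (T), `17/25, 7/10` (S). -/
theorem tubeConvexRefBox_of_hessCerts_C182 {B : E3 → E3 → (ℤ → E3) → Prop}
    (hA : HessCertAdjBox (fun a b w' => B a b w' ∧ PhiT a b) (24071 / 10000) (132864 / 10000) (25136 / 10000))
    (hF : HessCertFarBox (fun a b w' => B a b w' ∧ PhiT a b) alT alN ga 6)
    (hA' : HessCertAdjBox (fun a b w' => B a b w' ∧ PhiS a b) (62184 / 10000) (146168 / 10000) (44815 / 10000))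
    (hF' : HessCertFarBox (fun a b w' => B a b w' ∧ PhiS a b) alT' alN' ga' 6) : TubeConvexRefBox (17 / 16) (1 / 40) B := by
  refine tubeConvexRefBox_of_hessCerts₆ hA (θ := 7 / 25) (lT := 17 / 10) (lN := 43 / 10) (by norm_num) (by norm_num) (by norm_num)
    (by norm_num) hF (θf := fun _ => 1 / 5) (μT := muT) (μN := muN) (fun _ => by norm_num) (fun s => by unfold ga; split_ifs <;> norm_num)
    (fun s => by unfold alT ga muT; split_ifs <;> norm_num) (fun s => by unfold alN ga muN; split_ifs <;> norm_num)
    muT_nonneg muN_nonneg sum_muT.le sum_muN.le (lam := 23 / 25) (by norm_num) (by norm_num) (by norm_num)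
    hA' (θ' := 17 / 25) (lT' := 317 / 100) (lN' := 401 / 50) (by norm_num) (by norm_num) (by norm_num) (by norm_num)
    hF' (θf' := fun _ => 7 / 10) (μT' := muT') (μN' := muN') (fun _ => by norm_num) (fun s => by unfold ga'; split_ifs <;> norm_num)
    (fun s => by unfold alT' ga' muT'; split_ifs <;> norm_num) (fun s => by unfold alN' ga' muN'; split_ifs <;> norm_num)
    muT'_nonneg muN'_nonneg sum_muT'.le sum_muN'.le (lam' := 4 / 5) (by norm_num) (by norm_num) (by norm_num)

/-- ★★ THE CONE-SIDE DELIVERABLE: on the box family, four box-restricted literal leaves give 7c♭‴ (tube uniqueness round every `B`-reference) —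
the form lens-4's re-pointed slot consumes. -/
theorem tubeUniquenessRefBox_of_leafCerts_C182 {B : E3 → E3 → (ℤ → E3) → Prop}
    (hAT : AdjacentChannelRefTBox (17 / 16) (1 / 40) B (17 / 10) (43 / 10)) (hBT : FarChannelBelowRefTBox (17 / 16) (1 / 40) B muT muN 6)
    (hAS : AdjacentChannelRefSBox (17 / 16) (1 / 40) B (317 / 100) (401 / 50))
    (hBS : FarChannelBelowRefSBox (17 / 16) (1 / 40) B muT' muN' 6) : TubeUniquenessRefBox (17 / 16) (1 / 40) B :=
  tubeUniquenessRefBox_of_convex (tubeConvexRefBox_of_leafCerts_C182 hAT hBT hAS hBS)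

end Summit.AtomisticToContinuum.Crystallization.Theorems.ChartedPlanarOrderTubeChannelsBox

end
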